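import Summits.Ventures.Crystal3D.Theorems.StickyWulffConstantGenericWallFloorShellRowCertBridgeB
import HarnessLib

/-!
# Lane G's two-centre SHELL ROW, part 4: the seven certified rows `shellRow_G1 … shellRow_G7` (crux `GenericWallFloor`, line `WallLedgerG`; COMPUTATIONAL: `native_decide`)

HONEST FRAMING. Venture `Summits/Ventures/Crystal3D` (cell `crystal3d-full`), helper `--supports` the crux
`GenericWallFloor` (stmt-Ventures-19480) of `route-Ventures-StickyWulffConstant`, REGISTERED line `WallLedgerG`, open
stub `stub_twoSlabAdhesion`.  Rung credit only; F-C1 not moved; NOT the stub.  AUTHORSHIP: written by the cell's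
certified-computation planner cf-p2 g18 (PREREG §43, HOME/cf-p2/gtwo/bridge/ShellRowCertFull.lean, kit j314276, 0 sorries)
and landed verbatim (split into tree-sized files, docstrings added) by 19480-p1 g9 on cf-p1's instruction §86(94)/(100).
THE OBJECT (PREREG-G-TWOCENTRE, 19480-p1 g8; vocabulary `…GenericWallFloorShellRowDefs`, p653220): the TWO-CENTRE SHELL ROW of
lane G — a ball `z` of a unit packing CARRYING a shell class (its contacts and its non-contact neighbours within `√(8/3)` at the
listed relative cubic positions) has at most `bound` contacts (`ShellRowHolds`).  Certificate: the unit sphere about `z` is covered by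
the open unit balls about the listed points (so any further touching ball would overlap one of them), checked on a cube-map grid of
`6N²` cells by an exact integer inequality per cell (`shellCellCovered`; radial-projection Lipschitz bound `natSqrtCeil`).

This file (COMPUTATIONAL — kernel-external evaluation by `native_decide` of the integer cover checks, `6N²` cells with `N = 12` resp. `8`, and of
the consistency of the integer data with the class data): `shellCover_G1 … shellCover_G7` and **`shellRow_G1 … shellRow_G7 : ShellRowHolds shellClassGk`**
— in every unit packing a ball carrying class `Gk` of PREREG-G-TWOCENTRE §8 has at most `deg(Gk) ∈ {8, 9, 10}` contacts (the row pays `12 − deg ≥ 2`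
credits at that ball: the `c₀ = 1` instrument on the `Σ3`/`Σ9` cap, cf-p1 (xxxix)).  Exact-rational certificates: HOME/cf-p2/gtwo/ (g_cert.py,
g_shellrow_cert.json, kit j314276).
WHAT THIS IS NOT: not the stub; no statement about which packings carry the classes (that is the coverage glue); F-C1 not moved.
-/

noncomputable section

namespace Summit.Ventures.Crystal3D.Theorems

open Finset
open scoped InnerProductSpace RealInnerProductSpace

/-- Covering certificate for `shellClassG1evenTdeg8` at resolution N = 12 (864 cells). -/
theorem shellCover_G1 : shellCoverCheck 12 q3G1 = true := by native_decide

/-- Covering certificate for `shellClassG2oddA2deg8` at resolution N = 12 (864 cells). -/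
theorem shellCover_G2 : shellCoverCheck 12 q3G2 = true := by native_decide

/-- Covering certificate for `shellClassG3evenA2deg9` at resolution N = 12 (864 cells). -/
theorem shellCover_G3 : shellCoverCheck 12 q3G3 = true := by native_decide

/-- Covering certificate for `shellClassG4evenA2deg10` at resolution N = 8 (384 cells). -/
theorem shellCover_G4 : shellCoverCheck 8 q3G4 = true := by native_decide

/-- Covering certificate for `shellClassG5evenTdeg10` at resolution N = 12 (864 cells). -/
theorem shellCover_G5 : shellCoverCheck 12 q3G5 = true := by native_decide

/-- Covering certificate for `shellClassG6oddA2deg10` at resolution N = 12 (864 cells). -/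
theorem shellCover_G6 : shellCoverCheck 12 q3G6 = true := by native_decide

/-- Covering certificate for `shellClassG7oddTdeg10` at resolution N = 8 (384 cells). -/
theorem shellCover_G7 : shellCoverCheck 8 q3G7 = true := by native_decide

/-- Consistency of the integer data with the class data (G1). -/
theorem shellClassG1evenTdeg8_q3 : shellClassG1evenTdeg8.q3 = q3G1 := by native_decide

/-- Row G1: in every unit packing a ball carrying `shellClassG1evenTdeg8` has at most `shellClassG1evenTdeg8.bound` contacts. -/
theorem shellRow_G1 : ShellRowHolds shellClassG1evenTdeg8 :=
  shellRowHolds_of_coverCheck _ 12 (by native_decide) (by rw [shellClassG1evenTdeg8_q3]; exact shellCover_G1)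

/-- Consistency of the integer data with the class data (G2). -/
theorem shellClassG2oddA2deg8_q3 : shellClassG2oddA2deg8.q3 = q3G2 := by native_decide

/-- Row G2: in every unit packing a ball carrying `shellClassG2oddA2deg8` has at most `shellClassG2oddA2deg8.bound` contacts. -/
theorem shellRow_G2 : ShellRowHolds shellClassG2oddA2deg8 :=
  shellRowHolds_of_coverCheck _ 12 (by native_decide) (by rw [shellClassG2oddA2deg8_q3]; exact shellCover_G2)

/-- Consistency of the integer data with the class data (G3). -/
theorem shellClassG3evenA2deg9_q3 : shellClassG3evenA2deg9.q3 = q3G3 := by native_decide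

/-- Row G3: in every unit packing a ball carrying `shellClassG3evenA2deg9` has at most `shellClassG3evenA2deg9.bound` contacts. -/
theorem shellRow_G3 : ShellRowHolds shellClassG3evenA2deg9 :=
  shellRowHolds_of_coverCheck _ 12 (by native_decide) (by rw [shellClassG3evenA2deg9_q3]; exact shellCover_G3)

/-- Consistency of the integer data with the class data (G4). -/
theorem shellClassG4evenA2deg10_q3 : shellClassG4evenA2deg10.q3 = q3G4 := by native_decide

/-- Row G4: in every unit packing a ball carrying `shellClassG4evenA2deg10` has at most `shellClassG4evenA2deg10.bound` contacts. -/
theorem shellRow_G4 : ShellRowHolds shellClassG4evenA2deg10 :=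
  shellRowHolds_of_coverCheck _ 8 (by native_decide) (by rw [shellClassG4evenA2deg10_q3]; exact shellCover_G4)

/-- Consistency of the integer data with the class data (G5). -/
theorem shellClassG5evenTdeg10_q3 : shellClassG5evenTdeg10.q3 = q3G5 := by native_decide

/-- Row G5: in every unit packing a ball carrying `shellClassG5evenTdeg10` has at most `shellClassG5evenTdeg10.bound` contacts. -/
theorem shellRow_G5 : ShellRowHolds shellClassG5evenTdeg10 :=
  shellRowHolds_of_coverCheck _ 12 (by native_decide) (by rw [shellClassG5evenTdeg10_q3]; exact shellCover_G5)

/-- Consistency of the integer data with the class data (G6). -/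
theorem shellClassG6oddA2deg10_q3 : shellClassG6oddA2deg10.q3 = q3G6 := by native_decide

/-- Row G6: in every unit packing a ball carrying `shellClassG6oddA2deg10` has at most `shellClassG6oddA2deg10.bound` contacts. -/
theorem shellRow_G6 : ShellRowHolds shellClassG6oddA2deg10 :=
  shellRowHolds_of_coverCheck _ 12 (by native_decide) (by rw [shellClassG6oddA2deg10_q3]; exact shellCover_G6)

/-- Consistency of the integer data with the class data (G7). -/
theorem shellClassG7oddTdeg10_q3 : shellClassG7oddTdeg10.q3 = q3G7 := by native_decide

/-- Row G7: in every unit packing a ball carrying `shellClassG7oddTdeg10` has at most `shellClassG7oddTdeg10.bound` contacts. -/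
theorem shellRow_G7 : ShellRowHolds shellClassG7oddTdeg10 :=
  shellRowHolds_of_coverCheck _ 8 (by native_decide) (by rw [shellClassG7oddTdeg10_q3]; exact shellCover_G7)

end Summit.Ventures.Crystal3D.Theorems

end
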